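import Mathlib.Analysis.Matrix.Normed
import Mathlib.Analysis.SpecificLimits.Normed
import Mathlib.LinearAlgebra.Matrix.NonsingularInverse
import Mathlib.Topology.Algebra.Module.FiniteDimension
import HarnessLib

/-!
# Algebra of the linearisation of the scalar curvature at the flat metric

Support file (all results proved) for Bartnik's existence theorem for the ADM energy
(`Literature.Geometry.Lorentzian.AFEnd.HasADMEnergy_of_isAsymptoticallyFlat`). In coordinates
(`OpensChart.scalarCurvature_eq_coord`) the scalar curvature is
`S = ∑ g^{lk} g^{ji} [½(∂K − ∂K) − g^{ca} ¼KK + g^{ca} ¼KK]` with `K` the Koszul form (first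
derivatives of the metric) and `∂K` its derivatives (second derivatives of the metric). Bartnik's
argument (CPAM 39 (1986), (4.2)–(4.4); Lee, *Geometric Relativity*, proof of the well-definedness
of the ADM mass) replaces the inverse metric `g^{ab}` by `δ^{ab}` and drops the quadratic terms, at
the cost of an error `O(|g - δ| |∂²g| + |∂g|²)`. This file isolates the two elementary ingredients:

* `Matrix.abs_inv_sub_one_le` — **perturbation of the inverse**: if `|Aᵢⱼ − δᵢⱼ| ≤ ε` with
  `m ε ≤ 1/2` (`m` the size) then `|(A⁻¹)ᵢⱼ − δᵢⱼ| ≤ 2 m ε` and `|(A⁻¹)ᵢⱼ| ≤ 2` (Neumann series in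
  the normed ring of matrices with the `ℓ∞`-operator norm);
* `abs_curvatureSum_sub_linearSum_le` — **the algebraic estimate**: for arrays `P` (bounded by
  `p`), `K` (bounded by `q`) and a matrix `Gi` with `|Gi − 1| ≤ η`, `|Gi| ≤ 2`,
  `|∑ Gi Gi [½(P−P) − ∑ Gi ¼KK + ∑ Gi ¼KK] − ∑_{ki} ½(P_{ikki} − P_{kkii})| ≤ m⁴ 3ηp + m⁶ 4q²`.

## References

* R. Bartnik, *The mass of an asymptotically flat manifold*, CPAM 39 (1986), §4, (4.2)–(4.4).
* D. A. Lee, *Geometric Relativity* (AMS, 2019), Ch. 3 (ADM energy), proof of Thm. 3.? /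
  Prop. 3.? (well-definedness).
-/

noncomputable section

open Finset

namespace Literature.Geometry.Lorentzian

/-! ### Entry bounds for the `ℓ∞`-operator norm of matrices -/

section MatrixNorm

variable {n : Type*} [Fintype n] [DecidableEq n]

/-- **Perturbation of the inverse matrix.** If `|Aᵢⱼ − δᵢⱼ| ≤ ε` for all `i, j` and `m ε ≤ 1/2`
(`m` the size of the matrix), then `A` is invertible with `|(A⁻¹)ᵢⱼ − δᵢⱼ| ≤ 2 m ε` and
`|(A⁻¹)ᵢⱼ| ≤ 2`. Proof: with `t = 1 − A`, `‖t‖ ≤ m ε ≤ 1/2` for the `ℓ∞`-operator norm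
(Mathlib's `Matrix.linftyOpNormedRing`, used inside the proof only), so the Neumann series
`S = ∑ tᵏ` converges, `A S = 1`, `A⁻¹ − 1 = S − 1 = t S` and `‖S‖ ≤ (1 − ‖t‖)⁻¹ ≤ 2`; entries
are bounded by the norm. [folklore] -/
theorem Matrix.abs_inv_sub_one_le [Nonempty n] (A : Matrix n n ℝ) {ε : ℝ} (hε : 0 ≤ ε)
    (hsmall : Fintype.card n * ε ≤ 1 / 2)
    (h : ∀ i j, |A i j - (1 : Matrix n n ℝ) i j| ≤ ε) (i j : n) :
    |A⁻¹ i j - (1 : Matrix n n ℝ) i j| ≤ 2 * Fintype.card n * ε ∧ |A⁻¹ i j| ≤ 2 := by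
  letI : NormedRing (Matrix n n ℝ) := Matrix.linftyOpNormedRing
  letI : NormedSpace ℝ (Matrix n n ℝ) := Matrix.linftyOpNormedSpace
  haveI : NormOneClass (Matrix n n ℝ) := Matrix.linfty_opNormOneClass
  haveI : CompleteSpace (Matrix n n ℝ) := FiniteDimensional.complete ℝ (Matrix n n ℝ)
  -- entries are bounded by the norm, and the norm by the size times an entry bound
  have entry_le : ∀ (B : Matrix n n ℝ) (i j : n), |B i j| ≤ ‖B‖ := by
    intro B i j
    rw [Matrix.linfty_opNorm_def]
    have h1 : ‖B i j‖₊ ≤ ∑ j' : n, ‖B i j'‖₊ :=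
      Finset.single_le_sum (f := fun j' ↦ ‖B i j'‖₊) (fun _ _ ↦ bot_le) (Finset.mem_univ j)
    have h2 : (∑ j' : n, ‖B i j'‖₊) ≤
        (Finset.univ : Finset n).sup fun i : n ↦ ∑ j' : n, ‖B i j'‖₊ :=
      Finset.le_sup (f := fun i : n ↦ ∑ j' : n, ‖B i j'‖₊) (Finset.mem_univ i)
    have h := NNReal.coe_le_coe.2 (h1.trans h2)
    rw [coe_nnnorm, Real.norm_eq_abs] at h
    exact h
  have norm_le : ∀ (B : Matrix n n ℝ) {δ : ℝ} (hδ : 0 ≤ δ), (∀ i j, |B i j| ≤ δ) →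
      ‖B‖ ≤ Fintype.card n * δ := by
    intro B δ hδ hB
    rw [Matrix.linfty_opNorm_def]
    set δ' : NNReal := ⟨δ, hδ⟩ with hδ'
    have hentry : ∀ i j, ‖B i j‖₊ ≤ δ' := fun i j ↦ by
      rw [← NNReal.coe_le_coe, coe_nnnorm, Real.norm_eq_abs]
      exact hB i j
    have hsup : ((Finset.univ : Finset n).sup fun i : n ↦ ∑ j : n, ‖B i j‖₊) ≤
        Fintype.card n • δ' := by
      refine Finset.sup_le fun i _ ↦ ?_
      calc ∑ j : n, ‖B i j‖₊ ≤ ∑ _j : n, δ' := Finset.sum_le_sum fun j _ ↦ hentry i j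
        _ = Fintype.card n • δ' := by rw [Finset.sum_const, Finset.card_univ]
    have h1 := NNReal.coe_le_coe.2 hsup
    have h2 : ((Fintype.card n • δ' : NNReal) : ℝ) = Fintype.card n * δ := by
      rw [nsmul_eq_mul, NNReal.coe_mul, NNReal.coe_natCast]
      rfl
    exact h1.trans_eq h2
  set t : Matrix n n ℝ := 1 - A with ht_def
  have ht : ‖t‖ ≤ Fintype.card n * ε := by
    refine norm_le t hε fun i j ↦ ?_
    rw [ht_def, Matrix.sub_apply, abs_sub_comm]
    exact h i j
  have ht1 : ‖t‖ ≤ 1 / 2 := ht.trans hsmall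
  have ht' : ‖t‖ < 1 := by linarith
  set S : Matrix n n ℝ := ∑' k : ℕ, t ^ k with hS_def
  -- `A * S = 1`, hence `A⁻¹ = S`
  have hAS : A * S = 1 := by
    have := mul_neg_geom_series t ht'
    rwa [ht_def, sub_sub_cancel] at this
  have hinv : A⁻¹ = S := Matrix.inv_eq_right_inv hAS
  -- `S - 1 = t * S` and `‖S‖ ≤ 2`
  have hS1 : S - 1 = t * S := by
    have h1 := geom_series_mul_shift t ht'
    have h2 := geom_series_succ t ht'
    exact (h1.trans h2).symm
  have hSnorm : ‖S‖ ≤ 2 := by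
    have h1 := tsum_geometric_le_of_norm_lt_one t ht'
    have h2 : (1 - ‖t‖)⁻¹ ≤ 2 := by
      rw [inv_le_comm₀ (by linarith) two_pos]
      linarith
    have h3 : ‖(1 : Matrix n n ℝ)‖ = 1 := norm_one
    calc ‖S‖ = ‖∑' k : ℕ, t ^ k‖ := by rw [hS_def]
      _ ≤ ‖(1 : Matrix n n ℝ)‖ - 1 + (1 - ‖t‖)⁻¹ := h1
      _ ≤ 2 := by rw [h3]; linarith
  have hdiff : ‖A⁻¹ - 1‖ ≤ 2 * Fintype.card n * ε := by
    rw [hinv, hS1]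
    calc ‖t * S‖ ≤ ‖t‖ * ‖S‖ := norm_mul_le t S
      _ ≤ (Fintype.card n * ε) * 2 :=
          mul_le_mul ht hSnorm (norm_nonneg S) (by positivity)
      _ = 2 * Fintype.card n * ε := by ring
  have hentry : |A⁻¹ i j - (1 : Matrix n n ℝ) i j| ≤ 2 * Fintype.card n * ε := by
    have := entry_le (A⁻¹ - 1) i j
    rw [Matrix.sub_apply] at this
    exact this.trans hdiff
  refine ⟨hentry, ?_⟩
  have hone : |(1 : Matrix n n ℝ) i j| ≤ 1 := by
    rw [Matrix.one_apply]
    split_ifs <;> simp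
  calc |A⁻¹ i j| = |(A⁻¹ i j - (1 : Matrix n n ℝ) i j) + (1 : Matrix n n ℝ) i j| := by
        rw [sub_add_cancel]
    _ ≤ |A⁻¹ i j - (1 : Matrix n n ℝ) i j| + |(1 : Matrix n n ℝ) i j| := abs_add_le _ _
    _ ≤ 2 * Fintype.card n * ε + 1 := add_le_add hentry hone
    _ ≤ 2 := by nlinarith

end MatrixNorm

/-! ### The algebraic estimate -/

section Sums

variable {ι : Type*} [Fintype ι] [DecidableEq ι]

omit [DecidableEq ι] in
/-- `|∑ᵢ fᵢ| ≤ m c` if `|fᵢ| ≤ c`. [folklore] -/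
theorem abs_sum_le_card_mul (f : ι → ℝ) {c : ℝ} (h : ∀ i, |f i| ≤ c) :
    |∑ i, f i| ≤ Fintype.card ι * c :=
  calc |∑ i, f i| ≤ ∑ i, |f i| := Finset.abs_sum_le_sum_abs _ _
    _ ≤ ∑ _i : ι, c := Finset.sum_le_sum fun i _ ↦ h i
    _ = Fintype.card ι * c := by rw [Finset.sum_const, Finset.card_univ, nsmul_eq_mul]

/-- Contracting an index against the identity matrix: `∑ₗ δ_{lk} F(l) = F(k)`. [folklore] -/
theorem sum_one_apply_mul (k : ι) (F : ι → ℝ) :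
    ∑ l, (1 : Matrix ι ι ℝ) l k * F l = F k := by
  have : ∀ l, (1 : Matrix ι ι ℝ) l k * F l = if l = k then F l else 0 := fun l ↦ by
    rw [Matrix.one_apply]
    split_ifs <;> simp
  simp_rw [this]
  rw [Finset.sum_ite_eq']
  simp

/-- **The algebraic estimate behind the linearisation of the scalar curvature.** Let `Gi` be a
matrix with `|Giᵢⱼ − δᵢⱼ| ≤ η` and `|Giᵢⱼ| ≤ 2`, and `P`, `K` arrays bounded by `p`, `q`. Then the
coordinate expression of the scalar curvature (`OpensChart.scalarCurvature_eq_coord`, with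
`Gi = 𝒢⁻¹`, `P a b c d = ∂_{βₐ} K(β_b, β_c, β_d)`, `K a b c = K(βₐ, β_b, β_c)`) differs from its
linearisation at the identity, `∑_{k,i} ½(P i k k i − P k k i i)`, by at most `m⁴ 3ηp + m⁶ 4q²`
(`m = card ι`): the inverse metric is replaced by `δ` in the second-derivative terms
(`|Gi Gi − δδ| ≤ 3η`) and the quadratic terms are bounded by `4 m² q²` each.
Bartnik 1986, (4.2)–(4.4). [cite: Bartnik1986, §4, (4.2)–(4.4)] -/
theorem abs_curvatureSum_sub_linearSum_le (Gi : Matrix ι ι ℝ) (P : ι → ι → ι → ι → ℝ)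
    (K : ι → ι → ι → ℝ) {η p q : ℝ} (hη : 0 ≤ η) (hq : 0 ≤ q)
    (hGi : ∀ i j, |Gi i j - (1 : Matrix ι ι ℝ) i j| ≤ η) (hGi2 : ∀ i j, |Gi i j| ≤ 2)
    (hP : ∀ a b c d, |P a b c d| ≤ p) (hK : ∀ a b c, |K a b c| ≤ q) :
    |(∑ k, ∑ l, Gi l k * ∑ i, ∑ j, Gi j i *
        (2⁻¹ * (P i l k j - P k l i j)
          - ∑ a, ∑ c, Gi c a * (2⁻¹ * K j i c) * (2⁻¹ * K l k a)
          + ∑ a, ∑ c, Gi c a * (2⁻¹ * K j k c) * (2⁻¹ * K l i a)))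
      - ∑ k, ∑ i, 2⁻¹ * (P i k k i - P k k i i)|
    ≤ (Fintype.card ι) ^ 4 * (3 * η * p) + (Fintype.card ι) ^ 6 * (4 * q ^ 2) := by
  set m : ℝ := (Fintype.card ι : ℝ) with hm
  have hm0 : 0 ≤ m := by positivity
  -- the quadratic terms
  set Q₁ : ι → ι → ι → ι → ℝ := fun k l i j ↦
    ∑ a, ∑ c, Gi c a * (2⁻¹ * K j i c) * (2⁻¹ * K l k a) with hQ₁
  set Q₂ : ι → ι → ι → ι → ℝ := fun k l i j ↦
    ∑ a, ∑ c, Gi c a * (2⁻¹ * K j k c) * (2⁻¹ * K l i a) with hQ₂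
  have hQbound : ∀ (X Y : ι → ι → ℝ), (∀ a c, |X a c| ≤ q) → (∀ a c, |Y a c| ≤ q) →
      ∀ u v w z : ι, |∑ a, ∑ c, Gi c a * (2⁻¹ * X u c) * (2⁻¹ * Y v a)| ≤ m ^ 2 * (q ^ 2 / 2) := by
    intro X Y hX hY u v w z
    have hinner : ∀ a, |∑ c, Gi c a * (2⁻¹ * X u c) * (2⁻¹ * Y v a)| ≤ m * (q ^ 2 / 2) := by
      intro a
      refine abs_sum_le_card_mul _ fun c ↦ ?_
      rw [abs_mul, abs_mul, abs_mul, abs_mul]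
      have h1 := hGi2 c a
      have h2 := hX u c
      have h3 := hY v a
      have : |(2 : ℝ)⁻¹| = 2⁻¹ := abs_of_pos (by norm_num)
      rw [this]
      have hq2 : |X u c| * |Y v a| ≤ q * q := mul_le_mul h2 h3 (abs_nonneg _) hq
      nlinarith [abs_nonneg (Gi c a), abs_nonneg (X u c), abs_nonneg (Y v a)]
    calc |∑ a, ∑ c, Gi c a * (2⁻¹ * X u c) * (2⁻¹ * Y v a)| ≤ m * (m * (q ^ 2 / 2)) :=
          abs_sum_le_card_mul _ hinner
      _ = m ^ 2 * (q ^ 2 / 2) := by ring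
  have hQ₁b : ∀ k l i j, |Q₁ k l i j| ≤ m ^ 2 * (q ^ 2 / 2) := fun k l i j ↦
    hQbound (fun u c ↦ K u i c) (fun v a ↦ K v k a) (fun _ _ ↦ hK ..) (fun _ _ ↦ hK ..) j l k i
  have hQ₂b : ∀ k l i j, |Q₂ k l i j| ≤ m ^ 2 * (q ^ 2 / 2) := fun k l i j ↦
    hQbound (fun u c ↦ K u k c) (fun v a ↦ K v i a) (fun _ _ ↦ hK ..) (fun _ _ ↦ hK ..) j l k i
  -- the linearised sum as a contracted quadruple sum
  set T : ι → ι → ι → ι → ℝ := fun k l i j ↦ 2⁻¹ * (P i l k j - P k l i j) with hT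
  have hTb : ∀ k l i j, |T k l i j| ≤ p := by
    intro k l i j
    simp only [hT]
    rw [abs_mul, abs_of_pos (by norm_num : (0 : ℝ) < 2⁻¹)]
    have := abs_sub (P i l k j) (P k l i j)
    have h1 := hP i l k j
    have h2 := hP k l i j
    linarith
  have hlin : ∑ k, ∑ i, 2⁻¹ * (P i k k i - P k k i i) =
      ∑ k, ∑ l, ∑ i, ∑ j, (1 : Matrix ι ι ℝ) l k * ((1 : Matrix ι ι ℝ) j i * T k l i j) := by
    refine Finset.sum_congr rfl fun k _ ↦ ?_
    rw [Finset.sum_comm]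
    refine Finset.sum_congr rfl fun i _ ↦ ?_
    symm
    calc ∑ l, ∑ j, (1 : Matrix ι ι ℝ) l k * ((1 : Matrix ι ι ℝ) j i * T k l i j)
        = ∑ l, (1 : Matrix ι ι ℝ) l k * ∑ j, (1 : Matrix ι ι ℝ) j i * T k l i j :=
          Finset.sum_congr rfl fun l _ ↦ (Finset.mul_sum _ _ _).symm
      _ = ∑ j, (1 : Matrix ι ι ℝ) j i * T k k i j :=
          sum_one_apply_mul k fun l ↦ ∑ j, (1 : Matrix ι ι ℝ) j i * T k l i j
      _ = T k k i i := sum_one_apply_mul i fun j ↦ T k k i j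
      _ = 2⁻¹ * (P i k k i - P k k i i) := rfl
  -- rewrite the full sum as a quadruple sum
  have hfull : (∑ k, ∑ l, Gi l k * ∑ i, ∑ j, Gi j i *
      (2⁻¹ * (P i l k j - P k l i j) - Q₁ k l i j + Q₂ k l i j)) =
      ∑ k, ∑ l, ∑ i, ∑ j, Gi l k * (Gi j i * (T k l i j - Q₁ k l i j + Q₂ k l i j)) := by
    refine Finset.sum_congr rfl fun k _ ↦ Finset.sum_congr rfl fun l _ ↦ ?_
    rw [Finset.mul_sum]
    refine Finset.sum_congr rfl fun i _ ↦ ?_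
    rw [Finset.mul_sum]
  -- termwise estimate
  have hterm : ∀ k l i j, |Gi l k * (Gi j i * (T k l i j - Q₁ k l i j + Q₂ k l i j)) -
      (1 : Matrix ι ι ℝ) l k * ((1 : Matrix ι ι ℝ) j i * T k l i j)| ≤
      3 * η * p + m ^ 2 * (4 * q ^ 2) := by
    intro k l i j
    have e : Gi l k * (Gi j i * (T k l i j - Q₁ k l i j + Q₂ k l i j)) -
        (1 : Matrix ι ι ℝ) l k * ((1 : Matrix ι ι ℝ) j i * T k l i j) =
        ((Gi l k - (1 : Matrix ι ι ℝ) l k) * Gi j i +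
          (1 : Matrix ι ι ℝ) l k * (Gi j i - (1 : Matrix ι ι ℝ) j i)) * T k l i j +
        Gi l k * Gi j i * (Q₂ k l i j - Q₁ k l i j) := by ring
    rw [e]
    have hone : |(1 : Matrix ι ι ℝ) l k| ≤ 1 := by
      rw [Matrix.one_apply]; split_ifs <;> simp
    have hA : |((Gi l k - (1 : Matrix ι ι ℝ) l k) * Gi j i +
        (1 : Matrix ι ι ℝ) l k * (Gi j i - (1 : Matrix ι ι ℝ) j i)) * T k l i j| ≤ 3 * η * p := by
      rw [abs_mul]
      have h1 : |(Gi l k - (1 : Matrix ι ι ℝ) l k) * Gi j i +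
          (1 : Matrix ι ι ℝ) l k * (Gi j i - (1 : Matrix ι ι ℝ) j i)| ≤ 3 * η := by
        refine (abs_add_le _ _).trans ?_
        rw [abs_mul, abs_mul]
        have := hGi l k; have := hGi2 j i; have := hGi j i
        nlinarith [abs_nonneg (Gi l k - (1 : Matrix ι ι ℝ) l k), abs_nonneg (Gi j i),
          abs_nonneg (Gi j i - (1 : Matrix ι ι ℝ) j i), abs_nonneg ((1 : Matrix ι ι ℝ) l k)]
      have h2 := hTb k l i j
      exact mul_le_mul h1 h2 (abs_nonneg _) (by positivity)
    have hB : |Gi l k * Gi j i * (Q₂ k l i j - Q₁ k l i j)| ≤ m ^ 2 * (4 * q ^ 2) := by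
      rw [abs_mul, abs_mul]
      have h1 := hGi2 l k; have h2 := hGi2 j i
      have h3 : |Q₂ k l i j - Q₁ k l i j| ≤ m ^ 2 * q ^ 2 := by
        have := abs_sub (Q₂ k l i j) (Q₁ k l i j)
        have := hQ₁b k l i j; have := hQ₂b k l i j
        linarith
      have h12 : |Gi l k| * |Gi j i| ≤ 2 * 2 := mul_le_mul h1 h2 (abs_nonneg _) zero_le_two
      calc |Gi l k| * |Gi j i| * |Q₂ k l i j - Q₁ k l i j| ≤ (2 * 2) * (m ^ 2 * q ^ 2) :=
            mul_le_mul h12 h3 (abs_nonneg _) (by positivity)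
        _ = m ^ 2 * (4 * q ^ 2) := by ring
    exact (abs_add_le _ _).trans (add_le_add hA hB)
  -- sum up
  rw [hfull, hlin]
  simp only [← Finset.sum_sub_distrib]
  calc |∑ k, ∑ l, ∑ i, ∑ j, (Gi l k * (Gi j i * (T k l i j - Q₁ k l i j + Q₂ k l i j)) -
          (1 : Matrix ι ι ℝ) l k * ((1 : Matrix ι ι ℝ) j i * T k l i j))|
      ≤ m * (m * (m * (m * (3 * η * p + m ^ 2 * (4 * q ^ 2))))) :=
        abs_sum_le_card_mul _ fun k ↦ abs_sum_le_card_mul _ fun l ↦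
          abs_sum_le_card_mul _ fun i ↦ abs_sum_le_card_mul _ fun j ↦ hterm k l i j
    _ = m ^ 4 * (3 * η * p) + m ^ 6 * (4 * q ^ 2) := by ring

end Sums

end Literature.Geometry.Lorentzian

end
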